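import Mathlib
import HarnessLib
import HarnessLib.Audit
import Summits.KontsevichZagierPeriods.Statement
import Literature.AlgebraicGeometry.Motives.MonodromyCyclicFamily
import HarnessLib.Audit.Status.Attr

/-!
Route: GaussManinCertificates

DORMANT since 2026-08-24T22:39:53Z (reconciler: no traction for 7.1 d (last activity item-evidence-added at 2026-08-17T18:52:16Z); parked, not closed — `ledger route dormant route-KontsevichZagierPeriods-GaussManinCertificates --off` to) — unstaffed, not closed; items shared with open routes are served there. `ledger route dormant <id> --off` reactivates.

# Route GaussManinCertificates — families first — band Newton–Leibniz generates semialgebraic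
Stokes, and Gauss–Manin rigidity supplies rational certificates

X = KZStokes ∧ StokesFormKernel ("it suffices to show"). KZStokes (ENGINE): the band-only
Newton–Leibniz move of the H21 calculus generates Stokes's formula on EVERY bounded ℚ-semialgebraic
domain σ ⊂ ℝⁿ⁺¹ — a ℚ-semialgebraic primitive H, continuous on the closures of the vertical fibres
of σ, vanishing on their frontiers, with fibrewise derivative the integrand, makes [r] a relation
(this is the unproved sentence "Stokes … reduces to moves (1),(2),(3) by cylindrical decomposition"
of Statement.lean). StokesFormKernel (TARGET, rank 0): Conjecture 1 in Kontsevich–Zagier's own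
several-variable reading — ker eval is generated by the four moves together with these Stokes
instances. Card realised: gauss-manin-rational-certificates; its mechanism is the attack on
StokesFormKernel IN FAMILIES: transport in a parameter is one Newton–Leibniz move, and creative
telescoping / Gauss–Manin rigidity supply RATIONAL (admissible) certificates for the
monodromy-forced part. Since rev 7 this is carried by two SECTOR cruxes over
Literature.AlgebraicGeometry.Motives.MonodromyCyclicFamily — MonodromicSector (identically VANISHING
periods of a monodromy-cyclic family are relations at generic real-algebraic fibres) and
ParametricTransport (CONSTANT periods: real-algebraic fibres are pairwise KZ-equivalent along
parameter segments avoiding the certificate's poles) — and by the first complete instance, the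
Legendre family (LegendreSector ⇐ LegendreModulusPropagation + one CM fibre). No completion of
StokesFormKernel other than itself is claimed any more: the card's 'cyclic merging' crux B4
(stmt-3110, then stmt-14465) was retired after two crux-attacks showed every 'ker eval ≤ base ⊔
⟨generators⟩' formulation restates the target modulo the folklore normalisation of rule 3; the
target stays the route's rank-0 conjecture-grade item and the deciding theorem uses exactly KZStokes
and StokesFormKernel.
Lean: `KZStokes ∧ StokesFormKernel`

## Assembly
Pure algebra, proved (the deciding theorem `closes` in the route file; two further sorry-free proofs
are refuter evidence on item 3016): KZStokes puts every Stokes instance in `KZ.relations`, so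
`relations ⊔ closure(Stokes) = relations` (AddSubgroup.closure_le, sup_le); StokesFormKernel then
gives `KZ.eval ([r] − [r']) = 0 → [r] − [r'] ∈ relations`, i.e. the kernel form, and the summit
follows as in Theorems/KernelFormKernelImpliesStatement.lean (map_sub, eval_of).

Rationale: WHY THIS LINE. Every structural route on this summit (NoriTransfer, Grothendieck,
AyoubSpecialisation) ends in "transfer Stokes-type relators into
`Literature.NumberTheory.Transcendental.KZ.relations`", and none has isolated that transfer as a
typed statement; KZStokes is it, and it rests on a theorem in print (cylindrical decomposition with
continuous semialgebraic sections, BasuPollackRoy2006 Thm 5.6/Cor 5.7) plus the four moves. The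
card's point is WHERE admissible primitives come from: the calculus cannot integrate
(Literature.Barriers.KontsevichZagierPeriods.noSemialgebraicPrimitive_inv_sub_two) but it can
differentiate — d/dt of a period is a period, ∫ d/dt is one move, and finite-dimensionality of
relative de Rham cohomology forces ℚ(t)-linear relations whose certificates are RATIONAL
(BostanLairezSalvy2013 Thm 12: every rational F(t,x) has a telescoper with regular certificate;
Lairez2015; Griffiths1969); for a monodromy-CYCLIC family an identically vanishing (resp. constant)
period forces the class (resp. its Gauss–Manin derivative) to vanish (comparison + analytic
continuation along the monodromy orbit, Deligne1971 fixed part), hence an algebraic primitive, hence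
a KZ derivation at every generic algebraic fibre (resp. along every parameter segment) —
unconditional sector theorems, where Ayoub2015 proves the relative statement only over Laurent
series. Imported: algebraic de Rham cohomology in families / D-finiteness (algebraic geometry,
computer algebra), real algebraic geometry (CAD). Textbook instance checked here: Legendre's
relation, whose m-derivative has the explicit algebraic certificate ∂ₘF =
∂ₓ[½x(1−x²)y²κₘ(x)κ_{1−m}(y)] − ∂_y[½x²y(1−y²)κₘ(x)κ_{1−m}(y)] vanishing on the sides of the square
(MckeanMoll1999 §2.4; verified numerically).

RANKED CRUXES. #0 StokesFormKernel (target, conjecture-grade, auto-crux) — Conjecture 1 with a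
semialgebraic Stokes rule: every formal ℤ-combination of integral representations with value 0 lies
in the subgroup generated by the four H21 moves and the Stokes instances of KZStokes. (why it might
fail: it is Conjecture 1 (Stokes reading): GPC-strength barriers apply; false iff some period
identity is not generated by additivity, change of variables and semialgebraic Stokes (Neg's
pressure points: regularisation, Γ-detours).) [KontsevichZagier2001, HuberMullerStach2017,
Ayoub2015, CressonViusos2022]
#2 KZStokes (crux) — Newton–Leibniz on an arbitrary bounded ℚ-semialgebraic domain (card item B1,
all engines rest on it): r : IntegralRep (n+1) with bounded domain σ, H ℚ-semialgebraic on closure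
σ, s ↦ H(x,s) continuous on the closure of every vertical fibre σₓ and zero on its frontier, with
derivative r.integrand(x,t) at every interior point t of σₓ ⟹ [r] ∈ KZ.relations. Proof plan:
cylindrical decomposition of σ adapted to the last coordinate (cells = graphs, null, or bands over
base cells with continuous ℚ-semialgebraic sections), domain additivity, null cells are relations
([N]−[N]−[N]), one newtonLeibnizRel per maximal puncture-free run of bands (boundary values 0 by the
frontier hypothesis), [τ,0] ∈ relations. [difficulty: L] (why it might fail: needs ℚ-CAD with
continuous ℚ-semialgebraic sections (not in tree: cite request); newtonLeibnizRel wants the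
primitive semialgebraic on the CLOSED band and HasDerivAt at punctures inside σₓ — a run must be cut
at punctures, where H = 0 is forced only via the frontier clause.) [BasuPollackRoy2006, BCR1998,
KontsevichZagier2001, HuberMullerStach2017]
#3 LegendreSector (crux) — the Legendre sector of Conjecture 1: for every real-algebraic parameter m
∈ (0,1), the one-representation Legendre combination F_m(x,y) = κₘ(x)e_{1−m}(y) + eₘ(x)κ_{1−m}(y) −
κₘ(x)κ_{1−m}(y) on (0,1)² (κₘ = 1/√((1−x²)(1−mx²)), eₘ = √(1−mx²)/√(1−x²); value K E′ + E K′ − K K′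
= π/2, checked to 1e−13 at m = 1/2, 1/4, 1/3, 9/10) is KZ-equivalent to ∫_ℝ dx/(2(1+x²)). Card test
"Legendre at generic algebraic k = d/dk-identity + lemniscatic value": LegendreModulusPropagation +
the CM fibre m = 1/2 (Grothendieck item stmt-KontsevichZagierPeriods-0280, same value, integrand
symmetrised by one swap CoV). [deps: LegendreModulusPropagation] [difficulty: XL] (why it might
fail: the special fibre: 2EK − K² = π/2 at m = 1/2 is known only via Γ(1/4)-values or uniformisation
(MckeanMoll1999 §2.4); inside the calculus it needs an algebraic-correspondence proof on the
lemniscatic curve — Neg's Γ-detour pressure point.) [MckeanMoll1999, WhittakerWatson1927,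
Chudnovsky1976, KontsevichZagier2001]
#4 LegendreModulusPropagation (crux) — flat transport in the Legendre family (card engine (i) + "∫
d/dt is a move"; the Legendre instance of #6 with E = ∅ and an explicit pole-free certificate): for
real-algebraic m₀, m₁ ∈ (0,1) the Legendre representations F_{m₀}, F_{m₁} on (0,1)² are
KZ-equivalent. Plan: one newtonLeibnizRel in the parameter (band (0,1)² × [m₀,m₁], primitive F
itself) + integrand additivity, then the CERTIFICATE ∂ₘF = ∂ₓG₁ + ∂_yG₂ with G₁ =
½x(1−x²)y²κₘ(x)κ_{1−m}(y) (zero at x = 0,1) and G₂ = −½x²y(1−y²)κₘ(x)κ_{1−m}(y) (zero at y = 0,1) —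
verified by finite differences — and two applications of KZStokesBox after a coordinate-permutation
change of variables. [deps: KZStokesBox] [difficulty: M] (why it might fail: absolute integrability
of ∂ₓG₁, ∂_yG₂, ∂ₘF on the 3-box (edge singularities (1−x)^{-1/2}(1−y)^{-1/2}: fine on paper) and
ℚ-semialgebraicity of the junk-valued total functions at the faces must survive Lean's 1/0 = 0
conventions.) [MckeanMoll1999, WhittakerWatson1927, KontsevichZagier2001]
#9 KZStokesBox (support) — KZStokes on an open box (real corners; ℚ-semialgebraicity is carried by r
and by the hypothesis on H) (one band over the base box: newtonLeibnizRel + two null faces by domain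
additivity); unblocks LegendreModulusPropagation without the CAD fact. [difficulty: provable-now]
[KontsevichZagier2001, AyoubRelKZRevisited]
#5 MonodromicSector (crux; typed 2026-08-15 over
Literature.AlgebraicGeometry.Motives.MonodromyCyclicFamily) — the unconditional sector theorem (card
B3): an identically vanishing period P/Qᵏ of a monodromy-cyclic family has all but finitely many of
its real-algebraic fibres in KZ.relations (comparison + orbit span ⇒ class 0 ⇒ rational relative
primitive ⇒ KZStokes at the fibre). (why it might fail: certificate regularity on closure(σ_t₀) only
off the polar divisor; exactness rel D gives a certificate tangent to ∂σ, not coordinatewise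
vanishing; cyclicity load-bearing.) [Deligne1971, Griffiths1969, BostanLairezSalvy2013, Lairez2015,
Ayoub2015]
#6 ParametricTransport (crux; rev 7, replaces CyclicMerging 14465 — the refuters' typed repair C″,
taken in its segment form) — CONSTANT periods transport: for a monodromy-cyclic family and a form
P/Qᵏ with period function constant on J there is a finite E ⊂ ℝ such that the realised fibres at
real-algebraic t₀, t₁ ∈ J are KZ.Equivalent whenever [t₀,t₁] ∩ E = ∅ (∇_t[ω] pairs to 0 with the
orbit span ⇒ ∇_t[ω] = 0 rel D ⇒ rational certificate in (x,t) ⇒ one Newton–Leibniz move in t on the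
slab + KZStokes instances). Proper sector: KZKernelConjecture ⇒ it with E = ∅ (Sketch.lean,
parametricTransport_of_kernel), it bounds nothing of ker eval; κ = 0 is the pairwise shadow of #5;
#4 is its Legendre instance. [deps: KZStokes] [difficulty: XL] (why it might fail:
tangent-not-vanishing certificate on ∂σ_t needs boundary straightening; ℚ(t)-poles force E;
non-product slabs carry side-boundary Stokes terms.) [KontsevichZagier2001, Griffiths1969,
Deligne1970, Deligne1971, BostanLairezSalvy2013, Lairez2015, Ayoub2015, HuberMullerStach2017]
RETIRED (history kept in the file): CyclicMerging (B4; stmt-3110 informal → stmt-14465 typed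
'families normal form over the rule-3-free base'), crux-attacked 2026-08-15/16 by three refuter
passes as refuted-misstated = RESTATES THE TARGET (modulo the folklore normalisation NL ⊆
⟨1a,1b,2,slabs⟩ ⊔ ⟨Stokes⟩ and MonodromicSector it is ↔ StokesFormKernel; without slabs it is FALSE
by the dimension-0 evaluation invariant, FalseWithoutSlabs.lean), and its glue StokesKernelGlue
(stmt-14572, MonodromicSector → CyclicMerging → StokesFormKernel), dropped with it as moot.

TWO-LAYER PLAN. Foreseen glued splits (k ≤ 3, depth 1), filed only when a crux closes:
LegendreSector ⇐ LegendreModulusPropagation → LegendreHalfParameter (m = 1/2 fibre ~ π/2-rep, =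
Grothendieck 0280 up to a swap) → LegendreSector (glue = Equivalent.trans); KZStokes ⇐
KZStokesDimOne (n+1 = 1, finite unions of intervals, provable now) → KZStokesCells (given a CAD
hypothesis) → KZStokes; ParametricTransport ⇐ GMDerivativeVanishes (constant period + cyclic ⇒
∂_t(P/Qᵏ) dx is Stokes-exact rel D on the slab over every segment missing E, in the shape
Literature.AlgebraicGeometry.Motives.IsStokesExactOn one dimension up) → SlabTransport (a
Stokes-exact t-derivative on the slab + one Newton–Leibniz move in t ⇒ fibres equivalent; needs
KZStokes) → ParametricTransport; MonodromicSector splits the same way with 'class 0' in place of '∇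
class 0'.

KILL CRITERIA. Refutation of KZStokes (a semialgebraic Stokes instance provably outside
KZ.relations, via an additive invariant killing the four move sets — Neg item NegObstructionShape)
closes the route AND reports a defect of the H21 fixing of rule 3) to the operator. Refutation of
LegendreModulusPropagation would mean flat transport fails in the calculus: close
(refuted:LegendreModulusPropagation) and hand the witness to Neg. Refutation of LegendreSector with
LegendreModulusPropagation proved isolates the CM-fibre identity as non-derivable: file the negative
statement "special fibres are NOT reachable" (negative route). ParametricTransport and
MonodromicSector cannot be refuted by a numerical witness (their conclusions are instances of
Conjecture 1 on equal values); a refutation is therefore an additive invariant of KZ.relations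
separating two equal-valued fibres of a cyclic family = ¬KontsevichZagierPeriods outright — report
to the operator, the positive side of this route closes; a proof that the certificate mechanism
cannot reach the stated generality (e.g. torsion of the algebraic Gauss–Manin module at a
topologically good parameter, or an exactness-rel-D certificate not reducible to coordinatewise
Stokes) is a MISSTATEMENT signal: restate with the extra regularity hypothesis, do not close.
StokesFormKernel refuted ⇒ (with KZStokes) ¬KontsevichZagierPeriods. KZKernelConjecture proved
elsewhere moots everything but KZStokes.

NOT DECOMPOSED YET. (a) The honest residue of B4's 'merging' dictionary (Beukers–Siegel–Shidlovskii:
numerical relations at algebraic points are specialisations of functional ones) is the refuters'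
sector C′ FamilySpecialisation — every ℤ-relation Σ nᵢ·period(tᵢ) = 0 among finitely many
real-algebraic fibres of ONE form of ONE cyclic family lifts to KZ.relations — NOT filed: in general
it is Conjecture-1-strength with no engine beyond the target's; its elliptic instance (ℤ-relations
among K-values: isogenous moduli via Landen/modular correspondences as change-of-variables moves,
e.g. 4K(4/5) = 5K(1/4) is one Gauss substitution; non-isogenous moduli expectedly excluded via
Wüstholz's analytic subgroup theorem) belongs to the elliptic routes (HermiteRigidity's isogeny
transfer) and will be filed here only if LegendreSector closes. (b) Not split yet: the
comparison/orbit-span step and the Griffiths–Dwork certificate step shared by #5/#6 (see TWO-LAYER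
PLAN), the bootstrap corollary (r-fold vanishing at one non-singular algebraic point of an order-r
Picard–Fuchs operator is self-certifying), boundary-singular certificates (BLS regularity is only
off the polar divisor; integrands singular on ∂σ need a compactifying/blow-up change of variables
first), crossing a certificate pole e ∈ E (local freeness of the algebraic Gauss–Manin module at
topologically good parameters), coordinate-permutation change of variables and null-cell bookkeeping
(prover lemmas via --supports).

CHEAPEST FALSIFIER. (i) n+1 = 1 case of KZStokes (σ ⊂ ℝ a finite union of points and bounded
intervals): a prover can settle it now from newtonLeibnizRel with n = 0 — if even this fails the
typed hypotheses are wrong. (ii) The finite-difference check of the Legendre certificate (done: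
residual < 1e−9 at three random points) and the value π/2 of F_m (done: 1e−13). (iii) Lookup: is
"Stokes on semialgebraic chains from fibrewise FTC" already formalised anywhere (searched: no;
HuberMullerStach2017 §12.2 and Ayoub2015 Rem 1.5 treat it informally). (iv) ParametricTransport on
paper (done): n = 0 fibres coincide (refl); product box family with POLYNOMIAL integrand and
constant period — certificate by iterated fibre integration, E = ∅, moves = one Newton–Leibniz in t
+ n instances of KZStokesBox; n = 1 rational: constancy + cyclic poles ⇒ the residues of ∂_t F along
the pole branches vanish ⇒ Hermite reduction gives the rational x-primitive; and the NON-cyclic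
constant-period family r(t)[1/(x−α₁(t)) − 1/(x−α₂(t))] − r(t)[1/(x−β₁) − 1/(x−β₂)] + polynomial,
(1−α₁)α₂ = C(1−α₂)α₁, (1−β₁)β₂ = C(1−β₂)β₁, shows the certificate failing exactly where cyclicity
fails (poles wind together; orbit span ≠ H₁) — the hypothesis is load-bearing, the statement is not
vacuous.

NUMBERS. BostanLairezSalvy2013 Thm 12: telescoper with regular certificate of order ≤ dⁿ, degree
d^{O(n)}; Legendre family: Picard–Fuchs order 2 for K, E (MckeanMoll1999 §2.4: k(k′)²DK = E −
(k′)²K, kDE = E − K); F_m integrates to 1.5707963267949 ± 1e−13 at m ∈ {1/2, 1/4, 1/3, 9/10}. Items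
after rev 7: 8 active (target, assembly, 5 cruxes KZStokes / LegendreSector /
LegendreModulusPropagation / MonodromicSector / ParametricTransport, 1 support KZStokesBox);
retired: CyclicMerging (3110, 14465), StokesKernelGlue (14572).

DEFINITION REQUESTS. notion MonodromyCyclicFamily (topic Literature/AlgebraicGeometry/Motives) —
LANDED as Literature/AlgebraicGeometry/Motives/MonodromyCyclicFamily.lean (PeriodFamily,
toIntegralRep, periodFun, bettiClasses, monodromyOrbit, IsMonodromyCyclicAt, MonodromyCyclicFamily,
IsStokesExactOn, ofProduct; all bodies, no named facts): a smooth family of pairs (X, D) → T over a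
ℚ̄-curve with its relative algebraic de Rham cohomology, the Betti local system of the fibres with
monodromy, the comparison pairing, and the realisation of (rational n-form, semialgebraic relative
n-cycle) as `KZ.IntegralRep`; "σ cyclic" = the monodromy orbit of σ spans H_n(X_t, D_t; ℚ). Cite
request: cylindrical decomposition adapted to a ℚ-semialgebraic set with continuous ℚ-semialgebraic
sections (BasuPollackRoy2006 Def 5.1, Thm 5.6, Cor 5.7) as a Literature named fact for KZStokes.

Novelty: Searches (2026-08-15): the card's audited searches (lit search/vsearch "creative telescoping
Griffiths–Dwork certificate",
"fixed part period relations"; zbMATH 'telescoper regular certificate rational functions' 0 hits;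
KZ-conjecture lists, 34
rows) plus this session: `lit search --hybrid "Legendre's relation … proof by differentiation with
respect to the
modulus"` (8 docs; MckeanMoll1999 pp. 61–62 read: exact term x√(1−x²)/√(1−k²x²) vanishing at 0 and
1, constant from
the self-complementary modulus), `lit read arxiv:1301.4313 --grep certificate` (Thm 12 and §4.1
read), `lit read
book:basu2006 --grep Cylindrical` (Def 5.1/Thm 5.6/Cor 5.7 read), `lean search` for CAD/cell
decomposition in the tree
(none; SemialgebraicTriangulation.lean records the gap), `ledger negatives` (empty).
Nearest prior art found: BostanLairezSalvy2013 (doi:10.1145/2465506.2465935 = arXiv:1301.4313;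
telescopers with regular
certificates, no link to Conjecture 1), Lairez2015, Ayoub2015 Thm 1.8 (relative KZ over Laurent
series, motivic, no
certificate output), HuberMullerStach2017 Ch. 12–13 (Stokes relator informal; Rem 13.1.8 doubts the
rules presentation),
route AyoubSpecialisation item 0362 ("deform to families", informal) and item 0543 (cube calibration
of Stokes).
Delta: the Stokes transfer is isolated as ONE typed statement with an assembly proved now, and the
families mechanism is
made concrete — rational creative-telescoping certificates + flat transport as KZ moves, with the
Legendre family car  [refs: 10.1145/2465506.2465935, 1301.4313, arxiv:1301.4313, book:basu2006, doi:10.1145/2465506.2465935, MckeanMoll1999, BostanLairezSalvy2013, Lairez2015, Ayoub2015, HuberMullerStach2017]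

Barriers (technique_class: gauss-manin-certificate semialgebraic-stokes flat-transport): - technique_class: gauss-manin-certificate semialgebraic-stokes flat-transport
- Literature.Barriers.KontsevichZagierPeriods.noSemialgebraicPrimitive_inv_sub_two: evaded by
construction — KZStokes and the transport steps use Newton–Leibniz only with GIVEN admissible
primitives (certificates of exact forms, the integrand itself in the parameter direction), never a
primitive OF the integrand; no variable is eliminated by integration.
- Literature.Barriers.KontsevichZagierPeriods.kzConjecture_implies_oddZetaAlgIndep: applies to the
target StokesFormKernel only (it is Conjecture 1); KZStokes, LegendreModulusPropagation assert
nothing numerical, LegendreSector asserts one known identity.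
- Literature.Barriers.KontsevichZagierPeriods.kzConjecture_implies_twoPiI_log_algIndep: same —
confined to StokesFormKernel / CyclicMerging.
- Literature.Barriers.KontsevichZagierPeriods.kzConjecture_implies_ellipticPeriods_algIndep: same;
note LegendreSector is the one elliptic identity compatible with it (Chudnovsky1976: trdeg ℚ(K,E,π)
= 2).
- Literature.Barriers.KontsevichZagierPeriods.cressonViuSos_prop_3_2: not applicable — no single
global map between two representations is claimed; dissection (domain additivity over CAD cells) is
used throughout.
- Literature.Barriers.KontsevichZagierPeriods.not_complete_of_undecidable: consistent — all engines
are effective (CAD, Griffiths–Dwork reduction), no completeness-by-enumeration is claimed.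
- Negatives index: empty at filing (ledger negatives --pr

Novelty grade: new-combination — ROUTE REVIEW 2nd/3rd pass (refuter rreview-…-e48716e3: gen 0 stamped 6 typed items 13:56–13:58Z and PROVED Assembly — GMCAssemblyProof.lean on 3016; gen 2 re-check 14:30Z with a second sorry-free proof KZAssemblyProof.lean (axioms standard) + evidence REVIEW2-GaussManinCertificates.md; first pass 96 (refuter refuter-rreview-route-HodgeConjecture-Li-e48716e3-g2-0, 2026-08-15T14:32:48Z; prior: BostanLairezSalvy2013 doi:10.1145/2465506.2465935 = arXiv:1301.4313 Thm 12; Lairez2015, Ayoub2015 Thm 1.8 / Rem 1.5 (relative KZ over Laurent series), HuberMullerStach2017 Ch. 12–13 (Stokes relator informal; Rem 13.1.8), MckeanMoll1999 §2.4 (Legendre relation by differentiation in the modulus); BasuPollackRoy2006 Thm 5.6/Cor 5.7 (CAD), route AyoubSpecialisation item 0362 (deform to families, infor)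

History (route lifecycle, newest last):
- 2026-08-16T02:17:41Z · AUTO-CRUX: 1 conjecture-grade item(s) promoted to crux (StokesFormKernel) — refuter vetting / tiering apply (operator:999:1362873)
- 2026-08-16T03:27:33Z · rev 5: restated CyclicMerging (stmt-KontsevichZagierPeriods-3110) — repair (route-choice unit, 2026-08-16): CyclicMerging (stmt-3110, informal until now) was crux-attacked refuted-misstated on paper by rattack-3110 (2026-08-15T2 (planner-rchoice-KontsevichZagierPeriods-GaussM-f81d30ed-0)
- 2026-08-16T03:49:47Z · AUTO-CRUX (edit): StokesFormKernel — hypotheses of the deciding theorem that nothing in the route derives are cruxes (planner-rchoice-KontsevichZagierPeriods-GaussM-f81d30ed-0)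
- 2026-08-16T05:59:19Z · rev 7: restated CyclicMerging (stmt-KontsevichZagierPeriods-14465) — repair rev 7: CyclicMerging (stmt-14465) crux-attacked refuted-misstated = RESTATES THE TARGET (rattack-14465-0 / -g2-0: ↔ StokesFormKernel modulo NLNorm + Mono (planner-rrefute-KontsevichZagierPeriods-GaussM-f6af649b-0)
- 2026-08-16T05:59:19Z · rev 7: dropped StokesKernelGlue — repair rev 7: CyclicMerging (stmt-14465) crux-attacked refuted-misstated = RESTATES THE TARGET (rattack-14465-0 / -g2-0: ↔ StokesFormKernel modulo NLNorm + Mono (planner-rrefute-KontsevichZagierPeriods-GaussM-f6af649b-0)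
- 2026-08-24T22:39:53Z · DORMANT — reconciler: no traction for 7.1 d (last activity item-evidence-added at 2026-08-17T18:52:16Z); parked, not closed — `ledger route dormant route-KontsevichZagier (operator:999:1162322)

sub-problem: KontsevichZagierPeriods · status: dormant · opened planner-plancard-KontsevichZagierPeriods-Kont-3b22a952-0 2026-08-15T11:10:04Z · rev 8 · ledger route-KontsevichZagierPeriods-GaussManinCertificates
GENERATED by the gate from the ledger (D-0016/17). Provers cite these decls: `theorem foo : Summit.KontsevichZagierPeriods.KontsevichZagierPeriods.Theses.GaussManinCertificates.<Decl> := …` in Summits/KontsevichZagierPeriods/KontsevichZagierPeriods/Theorems/<Name>.lean.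
-/

namespace Summit.KontsevichZagierPeriods.KontsevichZagierPeriods.Theses.GaussManinCertificates

open scoped BigOperators Topology Manifold Classical MeasureTheory ProbabilityTheory Matrix InnerProductSpace ComplexConjugate ContinuousMap
open Filter Set Function TopologicalSpace MeasureTheory

attribute [summit_statement] _root_.KontsevichZagierPeriods

open Literature Periods

/-- item stmt-KontsevichZagierPeriods-3011 · crux (kind.auto-crux: conjecture-grade) · rank 0 · open · by planner
why it might fail: it is Conjecture 1 (Stokes reading): GPC-strength barriers apply; false iff some period identity is not generated by additivity, change of variables and semialgebraic Stokes (Neg's pressure points: regularisation, Γ-detours).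
sources: KontsevichZagier2001, HuberMullerStach2017, Ayoub2015, CressonViusos2022
[target] Conjecture 1 with a semialgebraic Stokes rule: every formal ℤ-combination of integral
representations with value 0 lies in the subgroup generated by the four H21 moves and the Stokes
instances of KZStokes. -/
@[route_item "route-KontsevichZagierPeriods-GaussManinCertificates", crux]
def StokesFormKernel : Prop :=
  ∀ c : Literature.NumberTheory.Transcendental.KZ.FormalRep, Literature.NumberTheory.Transcendental.KZ.eval c = 0 → c ∈ Literature.NumberTheory.Transcendental.KZ.relations ⊔ AddSubgroup.closure {d : Literature.NumberTheory.Transcendental.KZ.FormalRep | ∃ (n : ℕ) (r : Literature.NumberTheory.Transcendental.KZ.IntegralRep (n + 1)) (H : (Fin (n + 1) → ℝ) → ℝ), Bornology.IsBounded r.domain ∧ Literature.NumberTheory.Transcendental.IsSemialgebraicFunOn ℚ (closure r.domain) H ∧ (∀ x : Fin n → ℝ, ContinuousOn (fun s : ℝ => H (Fin.snoc x s)) (closure {s : ℝ | (Fin.snoc x s : Fin (n + 1) → ℝ) ∈ r.domain})) ∧ (∀ (x : Fin n → ℝ) (t : ℝ), t ∈ frontier {s : ℝ | (Fin.snoc x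 s : Fin (n + 1) → ℝ) ∈ r.domain} → H (Fin.snoc x t) = 0) ∧ (∀ (x : Fin n → ℝ) (t : ℝ), t ∈ interior {s : ℝ | (Fin.snoc x s : Fin (n + 1) → ℝ) ∈ r.domain} → HasDerivAt (fun s : ℝ => H (Fin.snoc x s)) (r.integrand (Fin.snoc x t)) t) ∧ d = Literature.NumberTheory.Transcendental.KZ.of r}

/-- item stmt-KontsevichZagierPeriods-19580 · crux · rank 2 · open · by planner
why it might fail: The fibrewise primitive must be REGULAR on all of the compact resolved domain and tangent to a possibly NON-SNC real boundary: needs embedded resolution as ONE KZ change of variables, an affine model after it (ample divisor without real points) and comparison for pairs over ℚ(t₀) — none in the tree.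
sources: Deligne1971, Griffiths1969, BostanLairezSalvy2013, HuberMullerStach2017, VoisinHodgeII2003, Hironaka1964
[crux · X₂ of the BC2-redirect split of StokesFormKernel (stmt-3011) · GEOMETRIC HALF ·
transcendence-free, theorem-grade; = MonodromicSector (stmt-3109) with EMPTY exceptional set, hence
implies 3109] For a monodromy-cyclic family 𝓕, a form P/Qᵏ whose period function vanishes
identically on J, and EVERY real-algebraic t₀ ∈ J, the realised fibre KZ.of (𝓕.toIntegralRep t₀ ht₀
halg P k) is a relation. Mechanism: vanishing on the real interval + cyclicity AT t₀ (J ⊂ good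
locus) ⇒ analytic continuation kills ⟨ω_{t₀}, orbit⟩ and the orbit spans Hₙ(X_{t₀}, D_{t₀}; ℚ) ⇒ the
class of ω_{t₀} in Hⁿ of the pair is 0 ⇒ comparison for smooth affine SNC pairs over ℚ(t₀) (after an
embedded resolution realised as ONE change-of-variables move and removal of an ample divisor without
real points) ⇒ ω'' = dG'' with G'' ∈ Γ(Ωⁿ⁻¹(log D'')(−D'')) ⇒ a flux-free ℚ-semialgebraic
certificate ⇒ Gauss–Green as KZ moves (integrand additivity + per-direction band Newton–Leibniz =
the PROVED KZStokes after coordinate permutation + patch re-parametrisation). E = ∅ because the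
certificate is taken FIBREWISE at each algebraic t₀, never the relative ℚ(t)-certificate whose poles
forced E in 3109/14682. Birth skeleton -/
@[route_item "route-KontsevichZagierPeriods-GaussManinCertificates", crux]
def VanishingFibres : Prop :=
  ∀ (n : ℕ) (𝓕 : Literature.AlgebraicGeometry.Motives.MonodromyCyclicFamily n) (P : MvPolynomial (Fin (n + 1)) ℚ) (k : ℕ), (∀ t ∈ 𝓕.toPeriodFamily.J, 𝓕.toPeriodFamily.periodFun P k t = 0) → ∀ (t₀ : ℝ) (ht₀ : t₀ ∈ 𝓕.toPeriodFamily.J) (halg : IsAlgebraic ℚ t₀), Literature.NumberTheory.Transcendental.KZ.of (𝓕.toPeriodFamily.toIntegralRep t₀ ht₀ halg P k) ∈ Literature.NumberTheory.Transcendental.KZ.relations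

/-- item stmt-KontsevichZagierPeriods-3012 · crux · rank 2 · closed · proved by Summit.KontsevichZagierPeriods.GaussManinCertificates.KZStokes_proof_eulerFormChain @ 56af62995ffd (prover) · by planner
why it might fail: needs ℚ-CAD with continuous ℚ-semialgebraic sections (not in tree: cite request); newtonLeibnizRel wants the primitive semialgebraic on the CLOSED band and HasDerivAt at punctures inside σₓ — a run must be cut at punctures, where H = 0 is forced only via the frontier clause.
sources: BasuPollackRoy2006, BCR1998, KontsevichZagier2001, HuberMullerStach2017
[crux] Newton–Leibniz on an arbitrary bounded ℚ-semialgebraic domain (card item B1, all engines rest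
on it): r : IntegralRep (n+1) with bounded domain σ, H ℚ-semialgebraic on closure σ, s ↦ H(x,s)
continuous on the closure of every vertical fibre σₓ and zero on its frontier, with derivative
r.integrand(x,t) at every interior point t of σₓ ⟹ [r] ∈ KZ.relations. Proof plan: cylindrical
decomposition of σ adapted to the last coordinate (cells = graphs, null, or bands over base cells
with continuous ℚ-semialgebraic sections), domain additivity, null cells are relations
([N]−[N]−[N]), one newtonLeibnizRel per maximal puncture-free run of bands (boundary values 0 by the
frontier hypothesis), [τ,0] ∈ relations. [difficulty: L] -/
@[route_item "route-KontsevichZagierPeriods-GaussManinCertificates", crux]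
def KZStokes : Prop :=
  ∀ (n : ℕ) (r : Literature.NumberTheory.Transcendental.KZ.IntegralRep (n + 1)) (H : (Fin (n + 1) → ℝ) → ℝ), Bornology.IsBounded r.domain → Literature.NumberTheory.Transcendental.IsSemialgebraicFunOn ℚ (closure r.domain) H → (∀ x : Fin n → ℝ, ContinuousOn (fun s : ℝ => H (Fin.snoc x s)) (closure {s : ℝ | (Fin.snoc x s : Fin (n + 1) → ℝ) ∈ r.domain})) → (∀ (x : Fin n → ℝ) (t : ℝ), t ∈ frontier {s : ℝ | (Fin.snoc x s : Fin (n + 1) → ℝ) ∈ r.domain} → H (Fin.snoc x t) = 0) → (∀ (x : Fin n → ℝ) (t : ℝ), t ∈ interior {s : ℝ | (Fin.snoc x s : Fin (n + 1) → ℝ) ∈ r.domain} → HasDerivAt (fun s : ℝ => H (Fin.snoc x s)) (r.integrand (Fin.snoc x t)) t) → Literature.NumberTheory.Transcendental.KZ.of r ∈ Literature.NumberTheory.Transcendental.KZ.relations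

/-- item stmt-KontsevichZagierPeriods-3013 · crux · rank 3 · open · by planner
why it might fail: the special fibre: 2EK − K² = π/2 at m = 1/2 is known only via Γ(1/4)-values or uniformisation (MckeanMoll1999 §2.4); inside the calculus it needs an algebraic-correspondence proof on the lemniscatic curve — Neg's Γ-detour pressure point.
sources: MckeanMoll1999, WhittakerWatson1927, Chudnovsky1976, KontsevichZagier2001
[crux] the Legendre sector of Conjecture 1: for every real-algebraic parameter m ∈ (0,1), the
one-representation Legendre combination F_m(x,y) = κₘ(x)e_{1−m}(y) + eₘ(x)κ_{1−m}(y) −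
κₘ(x)κ_{1−m}(y) on (0,1)² (κₘ = 1/√((1−x²)(1−mx²)), eₘ = √(1−mx²)/√(1−x²); value K E′ + E K′ − K K′
= π/2, checked to 1e−13 at m = 1/2, 1/4, 1/3, 9/10) is KZ-equivalent to ∫_ℝ dx/(2(1+x²)). Card test
"Legendre at generic algebraic k = d/dk-identity + lemniscatic value": LegendreModulusPropagation +
the CM fibre m = 1/2 (Grothendieck item stmt-KontsevichZagierPeriods-0280, same value, integrand
symmetrised by one swap CoV). [deps: LegendreModulusPropagation] [difficulty: XL] -/
@[route_item "route-KontsevichZagierPeriods-GaussManinCertificates"]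
def LegendreSector : Prop :=
  ∀ (F : ℝ → (Fin 2 → ℝ) → ℝ), (∀ (m : ℝ) (x : Fin 2 → ℝ), F m x = 1 / Real.sqrt ((1 - x 0 ^ 2) * (1 - m * x 0 ^ 2)) * (Real.sqrt (1 - (1 - m) * x 1 ^ 2) / Real.sqrt (1 - x 1 ^ 2)) + Real.sqrt (1 - m * x 0 ^ 2) / Real.sqrt (1 - x 0 ^ 2) * (1 / Real.sqrt ((1 - x 1 ^ 2) * (1 - (1 - m) * x 1 ^ 2))) - 1 / Real.sqrt ((1 - x 0 ^ 2) * (1 - m * x 0 ^ 2)) * (1 / Real.sqrt ((1 - x 1 ^ 2) * (1 - (1 - m) * x 1 ^ 2)))) → ∀ (m : ℝ), IsAlgebraic ℚ m → m ∈ Set.Ioo (0 : ℝ) 1 → ∀ (r : Literature.NumberTheory.Transcendental.KZ.IntegralRep 2) (r' : Literature.NumberTheory.Transcendental.KZ.IntegralRep 1), r.domain = {x | ∀ i, x i ∈ Set.Ioo (0 : ℝ) 1} → Set.EqOn r.integrand (F m) r.domain → r'.domain = Set.univ → Set.EqOn r'.integrand (fun x => 1 / (2 * (1 + x 0 ^ 2)))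 r'.domain → Literature.NumberTheory.Transcendental.KZ.Equivalent r r'

/-- item stmt-KontsevichZagierPeriods-3014 · crux · rank 4 · open · by planner
why it might fail: absolute integrability of ∂ₓG₁, ∂_yG₂, ∂ₘF on the 3-box (edge singularities (1−x)^{-1/2}(1−y)^{-1/2}: fine on paper) and ℚ-semialgebraicity of the junk-valued total functions at the faces must survive Lean's 1/0 = 0 conventions.
sources: MckeanMoll1999, WhittakerWatson1927, KontsevichZagier2001
[crux] flat transport in the Legendre family (card engine (i) + "∫ d/dt is a move"): for
real-algebraic m₀, m₁ ∈ (0,1) the Legendre representations F_{m₀}, F_{m₁} on (0,1)² are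
KZ-equivalent. Plan: one newtonLeibnizRel in the parameter (band (0,1)² × [m₀,m₁], primitive F
itself) + integrand additivity, then the CERTIFICATE ∂ₘF = ∂ₓG₁ + ∂_yG₂ with G₁ =
½x(1−x²)y²κₘ(x)κ_{1−m}(y) (zero at x = 0,1) and G₂ = −½x²y(1−y²)κₘ(x)κ_{1−m}(y) (zero at y = 0,1) —
verified by finite differences — and two applications of KZStokesBox after a coordinate-permutation
change of variables. [deps: KZStokesBox] [difficulty: M] -/
@[route_item "route-KontsevichZagierPeriods-GaussManinCertificates"]
def LegendreModulusPropagation : Prop :=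
  ∀ (F : ℝ → (Fin 2 → ℝ) → ℝ), (∀ (m : ℝ) (x : Fin 2 → ℝ), F m x = 1 / Real.sqrt ((1 - x 0 ^ 2) * (1 - m * x 0 ^ 2)) * (Real.sqrt (1 - (1 - m) * x 1 ^ 2) / Real.sqrt (1 - x 1 ^ 2)) + Real.sqrt (1 - m * x 0 ^ 2) / Real.sqrt (1 - x 0 ^ 2) * (1 / Real.sqrt ((1 - x 1 ^ 2) * (1 - (1 - m) * x 1 ^ 2))) - 1 / Real.sqrt ((1 - x 0 ^ 2) * (1 - m * x 0 ^ 2)) * (1 / Real.sqrt ((1 - x 1 ^ 2) * (1 - (1 - m) * x 1 ^ 2)))) → ∀ (m₀ m₁ : ℝ), IsAlgebraic ℚ m₀ → IsAlgebraic ℚ m₁ → m₀ ∈ Set.Ioo (0 : ℝ) 1 → m₁ ∈ Set.Ioo (0 : ℝ) 1 → ∀ (r₀ r₁ : Literature.NumberTheory.Transcendental.KZ.IntegralRep 2), r₀.domain = {x | ∀ i, x i ∈ Set.Ioo (0 : ℝ) 1} → r₁.domain = {x | ∀ i, x i ∈ Set.Ioo (0 : ℝ) 1} → Set.EqOn r₀.integrand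 (F m₀) r₀.domain → Set.EqOn r₁.integrand (F m₁) r₁.domain → Literature.NumberTheory.Transcendental.KZ.Equivalent r₀ r₁

/-- item stmt-KontsevichZagierPeriods-3109 · crux · rank 5 · open · by planner
why it might fail: certificate regularity on closure(σ_t0): BLS regularity holds only off the polar divisor, KZ integrands may blow up on ∂σ so boundary terms can diverge (compactifying CoV needed first); and cyclicity is load-bearing — without it the statement is conjecture-strength (scaling family t·c).
sources: Deligne1971, Griffiths1969, BostanLairezSalvy2013, Lairez2015, Ayoub2015, HuberMullerStach2017
[crux] MONODROMIC SECTOR (card item B3; the unconditional sector theorem of this line). For a smooth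
family of pairs (X, D) → T over a ℚ̄-curve T, a relative algebraic de Rham class ν ∈ Hⁿ_dR((X,D)/T)
realised fibrewise by ℚ-semialgebraic (after real/imaginary parts) integrands, and a semialgebraic
family of relative n-cycles σ_t ∈ H_n(X_t, D_t; ℚ) realised as KZ domains: IF the monodromy orbit of
σ spans H_n(X_t, D_t; ℚ) ("σ cyclic") and the period ⟨ν_t, σ_t⟩ vanishes identically on an interval,
THEN for every algebraic t₀ ∈ T at which the certificate is regular on the closure of σ_{t₀}, the KZ
representation of ⟨ν_{t₀}, σ_{t₀}⟩ lies in KZ.relations. Proof structure: analytic continuation ⇒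
ν_t pairs to 0 with the orbit span = all of homology ⇒ (comparison isomorphism) ν = 0 in relative de
Rham cohomology of the generic fibre over ℚ̄(T) ⇒ ν = d(G) rel D with G RATIONAL over ℚ̄(T)
(algebraic de Rham theory over the function field; Griffiths–Dwork / BostanLairezSalvy2013 Thm 12
make G explicit and regular off the polar divisor) ⇒ specialise at t₀ ⇒ KZStokes (item KZStokes,
summed over coordinate directions after permutation changes of variables). BOOTSTRAP corollary: for
cyclic σ an -/
@[route_item "route-KontsevichZagierPeriods-GaussManinCertificates"]
def MonodromicSector : Prop :=
  ∀ (n : ℕ) (𝓕 : Literature.AlgebraicGeometry.Motives.MonodromyCyclicFamily n) (P : MvPolynomial (Fin (n + 1)) ℚ) (k : ℕ), (∀ t ∈ 𝓕.toPeriodFamily.J, 𝓕.toPeriodFamily.periodFun P k t = 0) → ∃ E : Set ℝ, E.Finite ∧ ∀ (t₀ : ℝ) (ht₀ : t₀ ∈ 𝓕.toPeriodFamily.J) (halg : IsAlgebraic ℚ t₀), t₀ ∉ E → Literature.NumberTheory.Transcendental.KZ.of (𝓕.toPeriodFamily.toIntegralRep t₀ ht₀ halg P k) ∈ Literature.Nu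mberTheory.Transcendental.KZ.relations

/-- item stmt-KontsevichZagierPeriods-14682 · crux · rank 6 · open · by planner
why it might fail: Exactness rel D gives a certificate field TANGENT to ∂σ_t, not vanishing coordinatewise: reduction to KZStokes needs boundary-straightening CoV over a CAD; ℚ(t)-poles of the Griffiths–Dwork certificate force E (segments only); non-product slabs add side-boundary Stokes terms on D.
sources: KontsevichZagier2001, Griffiths1969, Deligne1970, Deligne1971, BostanLairezSalvy2013, Lairez2015
[crux] PARAMETRIC TRANSPORT (rev 7; replaces CyclicMerging stmt-14465, crux-attacked twice as
'restates the target' — the refuters' typed repair suggestion C″, re-derived and weakened to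
segments). For a monodromy-cyclic family 𝓕
(Literature.AlgebraicGeometry.Motives.MonodromyCyclicFamily n) and a form P/Qᵏ whose period function
t ↦ ∫_{σ_t} P/Qᵏ dx is CONSTANT (= κ) on the parameter interval J, there is a finite exceptional set
E ⊂ ℝ such that the realised fibres KZ.of (𝓕.toIntegralRep t₀ … P k) and KZ.of (𝓕.toIntegralRep t₁ …
P k) at real-algebraic t₀, t₁ ∈ J are KZ.Equivalent whenever the closed segment [t₀, t₁] misses E.
Mechanism (card engines (i)+(ii)+(iii) in one statement; generalises LegendreModulusPropagation from
the Legendre square to every cyclic family, and is the 'flat transport is a move' half of the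
retired B4): constant period ⇒ d/dt ⟨ω_t, σ_t⟩ ≡ 0 on J; analytic continuation keeps the period
constant along every loop in the good locus, so the relative Gauss–Manin derivative ∇_t[ω] pairs to
0 with the whole monodromy orbit of [σ_t], which SPANS H_n(X_t, D_t; ℚ) (cyclicity) ⇒ ∇_t[ω] = 0 in
H^n_dR((X_t, D_t)) ⇒ (affine X_t, algebraic de Rham over the function field, -/
@[route_item "route-KontsevichZagierPeriods-GaussManinCertificates"]
def ParametricTransport : Prop :=
  ∀ (n : ℕ) (𝓕 : Literature.AlgebraicGeometry.Motives.MonodromyCyclicFamily n) (P : MvPolynomial (Fin (n + 1)) ℚ) (k : ℕ) (κ : ℝ), (∀ t ∈ 𝓕.toPeriodFamily.J, 𝓕.toPeriodFamily.periodFun P k t = κ) → ∃ E : Set ℝ, E.Finite ∧ ∀ (t₀ t₁ : ℝ) (ht₀ : t₀ ∈ 𝓕.toPeriodFamily.J) (ht₁ : t₁ ∈ 𝓕.toPeriodFamily.J) (h₀ : IsAlgebraic ℚ t₀) (h₁ : IsAlgebraic ℚ t₁), Disjoint (Set.uIcc t₀ t₁) E → Literature.NumberTheory.Transcendental.KZ.Equivalent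 (𝓕.toPeriodFamily.toIntegralRep t₀ ht₀ h₀ P k) (𝓕.toPeriodFamily.toIntegralRep t₁ ht₁ h₁ P k)

/-- item stmt-KontsevichZagierPeriods-19581 · support · rank 9 · open · by planner
why it might fail: Fails only with the summit (summit-implied). As engine target: no Siegel–Shidlovskii analogue for G-functions (Rivoal 2015 Prop.1; Beukers–Wolfart dense algebraic ₂F₁-values), so the same-family ℚ(t)-linear lift is FALSE at CM fibres (K′=√d·K); the lift must change family — no such engine in print.
sources: KontsevichZagier2001, AyoubRelKZRevisited, Ayoub2015, HuberWustholz2022, Andre1989, Beukers2006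
[support (filed as SUPPORT only because of the 7-crux cap — would be crux rank 4; tenure: re-badge
to crux when the formal --split lands or a crux closes) · X₁ of the BC2-redirect split of
StokesFormKernel (stmt-3011) · ARITHMETIC HALF · flagged SUMMIT-IMPLIED (K → X₁ by le_sup_left) and
summit-EQUIVALENT modulo VanishingFibres — the route's declared arithmetic core, header NOT
DECOMPOSED YET (a) 'FamilySpecialisation'] Every formal ℤ-combination of integral representations
with value 0 lies in KZ.relations ⊔ ⟨KZ.of (𝓕.toIntegralRep t₀ …P k) : 𝓕 a MonodromyCyclicFamily, t₀
∈ J real-algebraic, periodFun P k ≡ 0 on J⟩ — 'every numerical identity between periods is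
generated, modulo the moves, by specialisations at algebraic parameters of FUNCTIONAL identities
(identically vanishing forms) of monodromy-cyclic families'. Sup/closure form (no family-existence
is asserted; base = full KZ.relations, so Theorems/CyclicMerging/Negative/FalseWithoutSlabs does not
apply; no ∀E device). Birth skeleton (Cruxes/StokesFormKernel/SplitX1CyclicLiftingBirth.lean):
stub_cyclicNormalForm (geometric: every period deforms in a cyclic family — Viu-Sos reduction +
Lefschetz-type pencils with big monodromy -/
@[route_item "route-KontsevichZagierPeriods-GaussManinCertificates", crux]
def CyclicLifting : Prop :=
  ∀ c : Literature.NumberTheory.Transcendental.KZ.FormalRep, Literature.NumberTheory.Transcendental.KZ.eval c = 0 → c ∈ Literature.NumberTheory.Transcendental.KZ.relations ⊔ AddSubgroup.closure {d : Literature.NumberTheory.Transcendental.KZ.FormalRep | ∃ (n : ℕ) (𝓕 : Literature.AlgebraicGeometry.Motives.MonodromyCyclicFamily n) (P : MvPolynomial (Fin (n + 1)) ℚ) (k : ℕ) (t₀ : ℝ) (ht₀ : t₀ ∈ 𝓕.toPeriodFamily.J) (halg : IsAlgebraic ℚ t₀), (∀ t ∈ 𝓕.toPeriodFamily.J, 𝓕.toPeriodFamily.periodFun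 P k t = 0) ∧ d = Literature.NumberTheory.Transcendental.KZ.of (𝓕.toPeriodFamily.toIntegralRep t₀ ht₀ halg P k)}

/-- item stmt-KontsevichZagierPeriods-19582 · support · rank 9 · open · by planner
sources: KontsevichZagier2001, HuberMullerStach2017
[support] GLUE of the BC2-redirect split of the restated deciding crux StokesFormKernel (stmt-3011;
crux-strategist r1, 2026-08-17): CyclicLifting → VanishingFibres → StokesFormKernel. Trivial seam
(flag trivial_seam): the vanishing cyclic fibres are relations by VanishingFibres, so KZ.relations ⊔
⟨them⟩ ≤ KZ.relations ≤ KZ.relations ⊔ ⟨Stokes instances⟩ (sup_le + AddSubgroup.closure_le +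
mem_sup_left). PROVED: Cruxes/StokesFormKernel/SplitGlue.lean (stokesFormKernel_of_pieces, lean
check rc 0, 0 sorry); by-name closing file Cruxes/StokesFormKernel/GlueClose.lean to be landed as
Theorems/GaussManinCertificatesStokesFormKernelOfPieces.lean. The formal `route edit --split
StokesFormKernel --into children.json --glue-by …` is left to a FINAL-cycle seat / tenure
(SPLIT-FILING.md): this seat's --split was bounced (final-cycle rule). [difficulty: provable-now] -/
@[route_item "route-KontsevichZagierPeriods-GaussManinCertificates"]
def StokesFormKernelOfPieces : Prop :=
  CyclicLifting → VanishingFibres → StokesFormKernel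

/-- item stmt-KontsevichZagierPeriods-3015 · support · rank 9 · closed · proved by Summit.KontsevichZagierPeriods.GaussManinCertificates.KZStokesBox_proof @ b1634edc3df5 (prover) · by planner
sources: KontsevichZagier2001, AyoubRelKZRevisited
[support] KZStokes on an open box (real corners; ℚ-semialgebraicity is carried by r and by the
hypothesis on H) (one band over the base box: newtonLeibnizRel + two null faces by domain
additivity); unblocks LegendreModulusPropagation without the CAD fact. [difficulty: provable-now] -/
@[route_item "route-KontsevichZagierPeriods-GaussManinCertificates"]
def KZStokesBox : Prop :=
  ∀ (n : ℕ) (a b : Fin (n + 1) → ℝ) (r : Literature.NumberTheory.Transcendental.KZ.IntegralRep (n + 1)) (H : (Fin (n + 1) → ℝ) → ℝ), (∀ i, a i < b i) → r.domain = {z | ∀ i, z i ∈ Set.Ioo (a i) (b i)} → Literature.NumberTheory.Transcendental.IsSemialgebraicFunOn ℚ {z | ∀ i, z i ∈ Set.Icc (a i) (b i)} H → (∀ x : Fin n → ℝ, (∀ i, x i ∈ Set.Ioo (a (Fin.castSucc i)) (b (Fin.castSucc i))) → ContinuousOn (fun s : ℝ => H (Fin.snoc x s)) (Set.Icc (a (Fin.last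 n)) (b (Fin.last n))) ∧ H (Fin.snoc x (a (Fin.last n))) = 0 ∧ H (Fin.snoc x (b (Fin.last n))) = 0 ∧ ∀ t ∈ Set.Ioo (a (Fin.last n)) (b (Fin.last n)), HasDerivAt (fun s : ℝ => H (Fin.snoc x s)) (r.integrand (Fin.snoc x t)) t) → Literature.NumberTheory.Transcendental.KZ.of r ∈ Literature.NumberTheory.Transcendental.KZ.relations

/-- item stmt-KontsevichZagierPeriods-3016 · assembly · rank 1 · closed · proved by Summit.KontsevichZagierPeriods.GaussManinCertificates.Assembly.assembly_proof (prover) · by planner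
sources: KontsevichZagier2001, HuberMullerStach2017
[assembly] KZStokes → StokesFormKernel → KontsevichZagierPeriods. -/
@[route_item "route-KontsevichZagierPeriods-GaussManinCertificates"]
def Assembly : Prop :=
  KZStokes → StokesFormKernel → KontsevichZagierPeriods

-- records of items no longer active in this route (dropped / restated):
-- earlier CyclicMerging (stmt-KontsevichZagierPeriods-14465, replaced 2026-08-16T05:59:19Z -> stmt-KontsevichZagierPeriods-14682): retired by None — ∀ E : (n : ℕ) → Literature.AlgebraicGeometry.Motives.MonodromyCyclicFamily n → MvPolynomial (Fin (n + 1)) ℚ → ℕ → Finset ℝ, ∀ c : Literature.NumberTheory.Transcendental.KZ.FormalRep, Literature.NumberTheory.Transcendental.KZ.eval c = 0 → c ∈ AddSubgroup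
-- earlier CyclicMerging (stmt-KontsevichZagierPeriods-3110, replaced 2026-08-16T03:27:33Z -> stmt-KontsevichZagierPeriods-14465): retired by None — ∀ E : (n : ℕ) → Literature.AlgebraicGeometry.Motives.MonodromyCyclicFamily n → MvPolynomial (Fin (n + 1)) ℚ → ℕ → Finset ℝ, ∀ c : Literature.NumberTheory.Transcendental.KZ.FormalRep, Literature.NumberTheory.Transcendental.KZ.eval c = 0 → c ∈ Literature.N

/-! D-0027 §2.1 — DECIDING THEOREM (planner-authored via `route open/edit --closes-file`; by planner-rbadge-KontsevichZagierPeriods-GaussMa-7edd2224-g2-0 2026-08-15T16:11:01Z):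
its hypotheses are this route's items and its conclusion the sub-problem Statement (glue_lint), and it elaborates with this file. -/

@[closes "route-KontsevichZagierPeriods-GaussManinCertificates"] theorem closes (h₁ : KZStokes) (h₂ : StokesFormKernel) : KontsevichZagierPeriods := by
  intro n m r r' _ _ hv
  have h0 : Literature.NumberTheory.Transcendental.KZ.eval
      (Literature.NumberTheory.Transcendental.KZ.of r - Literature.NumberTheory.Transcendental.KZ.of r') = 0 := by
    simp [Literature.NumberTheory.Transcendental.KZ.eval_of, hv]
  have hmem := h₂ _ h0
  refine (sup_le le_rfl ((AddSubgroup.closure_le _).mpr ?_)) hmem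
  rintro d ⟨k, ρ, H, hb, hsa, hcont, hfr, hder, rfl⟩
  exact h₁ k ρ H hb hsa hcont hfr hder

end Summit.KontsevichZagierPeriods.KontsevichZagierPeriods.Theses.GaussManinCertificates
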